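import Summits.QuantumFields.BalabanUV.T4Continuum.Support.OutputRateOpGaussianParam

/-!
# OutputRateOpGaussianParamWitness — non-vacuity of the parametrised Gaussian hook: a toy term family satisfying ALL thirteen
# clauses of `TermOpGaussianParam`, run through the producer to `TermOpHolomorphicBall` / `TermOpLineAnalytic` / `TermBound`
# (cell `pub-balaban`, T⁴ fan-out, `HOME/BINDER-OWNERS.md` row NE5, owner lineage t4-ne5-p1, gen 29, route P1)

HONEST FRAMING (T4-DAG PAGE 1).  Rung (B)+1 on ONE finite four-torus — NOT infinite volume, NOT a mass gap, NOT the Clay problem;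
`FlowStep.BetaPertH`, (B), (B^μ) do not occur here.  NE5 is NOT PRINTED and NOT PROVED (spine 0/9).  A TOY: nothing of Bałaban's series is
modelled or asserted; 0 cite tags.  HONEST DEPENDENCY (cell, verbatim): continuum YM on T⁴ ⇐ BetaPertH ∧ nine spine estimates (0/9 proved);
BetaPertH ⇐ (D1) ∧ (D4) ∧ CAP+tail; G-an2-4 gates asym, D1 and NE2/3/4.

WHY (the swarm's lesson G-ne5p2-5, journal l.9940: a displayed binder quantified too generously was kernel-certified UNSATISFIABLE for every
realistic core).  `OutputRateOpGaussianParam.TermOpGaussianParam` (p214635) displays thirteen clauses per term (finiteness of the parameter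
measure, margin constant, five measurability clauses two of which are JOINT on `β × α`, two holomorphy clauses, three bounds, the iterated
representation).  This module exhibits ONE family meeting all of them on the lineage's toy carriers — parameter space `Unit` with the Dirac
mass, fluctuation space `EuclideanSpace ℝ (Fin 1)`, Cauchy weight and prefactor `1`, insertion `1`, exponent `(1 + o)·‖v‖²` (the
one-dimensional shadow of a complex covariance, [II] p. 15: «the operators in it are not symmetric, and the second measure is complex»), margin
`m = 1/2`, `b = 0` on the operator ball `‖o‖ < 1/2` — and runs it through the producer: `toyParam_termOpGaussianParam`,
`toyParam_termOpHolomorphicBall`, `toyParam_termOpLineAnalytic` (room `1/4 < 1/2`), `toyParam_termBound` (budget = the mass `(π/(1/4))^{dim/2}` itself,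
`κ = 0`).  So the shape is satisfiable with its joint-measurability clauses as typed.  0 sorry; axioms ⊆ {propext, Classical.choice, Quot.sound}.
-/

noncomputable section

open Set Metric MeasureTheory Filter

namespace Summit.QuantumFields.BalabanUV.T4Continuum.OutputRateOpGaussianParamWitness

open Literature.MathematicalPhysics.QuantumFieldTheory.Balaban1983to89
open Literature.MathematicalPhysics.QuantumFieldTheory.Balaban1983to89.T4OutputRate
open Literature.MathematicalPhysics.QuantumFieldTheory.Balaban1983to89.T4InputCauchyRate
open Literature.MathematicalPhysics.QuantumFieldTheory.Balaban1983to89.T4InputCauchyRateData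
open Literature.MathematicalPhysics.QuantumFieldTheory.Balaban1983to89.T4InputCauchyRateSpecies
open Literature.MathematicalPhysics.QuantumFieldTheory.Balaban1983to89.T4InputCauchyRateTermwise
open Summit.QuantumFields.BalabanUV.T4Continuum.OutputRateOpHolomorphic
open Summit.QuantumFields.BalabanUV.T4Continuum.OutputRateOpGaussianParam

/-- the toy's fluctuation-field space: one real Gaussian variable, as a Euclidean space (so that `volume` is the inner-product Lebesgue
measure the hook integrates against). [folklore] -/
abbrev E1 : Type := EuclideanSpace ℝ (Fin 1)

/-- parameter measures: the Dirac mass on `Unit` for every term. [folklore] -/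
def toyLam : ∀ (_ : ℕ) (_ : Unit), ℂ → toyCarriers.Dom → Measure Unit := fun _ _ _ _ => Measure.dirac ()

/-- Cauchy weights: `1`. [folklore] -/
def toyW : ∀ (_ : ℕ) (_ : Unit), ℂ → toyCarriers.Dom → Unit → ℂ := fun _ _ _ _ _ => 1

/-- normalisation prefactors: `1`. [folklore] -/
def toyN : ∀ (_ : ℕ) (_ : Unit), ℂ → toyCarriers.Dom → ℂ → Unit → ℂ := fun _ _ _ _ _ _ => 1

/-- insertions: `1`. [folklore] -/
def toyG : ∀ (_ : ℕ) (_ : Unit), ℂ → toyCarriers.Dom → Unit → E1 → ℂ := fun _ _ _ _ _ _ => 1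

/-- exponents: `q(o, p, v) = (1 + o)·‖v‖²` — a complex "covariance" `1 + o`. [folklore] -/
def toyQ : ∀ (_ : ℕ) (_ : Unit), ℂ → toyCarriers.Dom → ℂ → Unit → E1 → ℂ := fun _ _ _ _ o _ v =>
  (1 + o) * ((‖v‖ ^ 2 : ℝ) : ℂ)

/-- constants: margin `m = 1/2`, shift `b = 0`, bounds `w₀ = N₀ = G₀ = 1`. [folklore] -/
def cHalf : ℕ → Unit → ℂ → toyCarriers.Dom → ℝ := fun _ _ _ _ => 1 / 2
/-- the constant `0` in the hook's constant slots. [folklore] -/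
def cZero : ℕ → Unit → ℂ → toyCarriers.Dom → ℝ := fun _ _ _ _ => 0
/-- the constant `1` in the hook's constant slots. [folklore] -/
def cOne : ℕ → Unit → ℂ → toyCarriers.Dom → ℝ := fun _ _ _ _ => 1

/-- THE TOY TERM FAMILY, defined AS the iterated integral of the hook (so the representation clause is definitional):
`T k i o h X = ∫ w·N(o,·)·(∫ gIns·e^{−q(o,·,v)} dv) dδ_()`. [folklore] -/
def toyParamTerm : ℕ → Unit → ℂ → ℂ → toyCarriers.Dom → ℂ := fun k i o h X =>
  ∫ p, toyW k i h X p * toyN k i h X o p * ∫ v, toyG k i h X p v * Complex.exp (-toyQ k i h X o p v) ∂volume ∂(toyLam k i h X)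

/-- the real part of the toy exponent: `Re((1 + o)‖v‖²) = (1 + Re o)‖v‖²`. [folklore] -/
theorem re_toyQ (o : ℂ) (v : E1) : ((1 + o) * ((‖v‖ ^ 2 : ℝ) : ℂ)).re = (1 + o.re) * ‖v‖ ^ 2 := by
  rw [Complex.re_mul_ofReal]; simp

/-- THE MARGIN on the operator ball `‖o‖ < 1/2`: `Re q(o, p, v) ≥ ½‖v‖² − 0`. [folklore] -/
theorem toyQ_margin {o : ℂ} (ho : o ∈ ball (0 : ℂ) (1 / 2)) (v : E1) :
    1 / 2 * ‖v‖ ^ 2 - 0 ≤ ((1 + o) * ((‖v‖ ^ 2 : ℝ) : ℂ)).re := by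
  rw [re_toyQ, sub_zero]
  refine mul_le_mul_of_nonneg_right ?_ (sq_nonneg _)
  rw [mem_ball, dist_zero_right] at ho
  have h := (abs_le.1 (Complex.abs_re_le_norm o)).1
  linarith

/-- joint measurability of the toy exponent on `Unit × E1` (for each operator datum). [folklore] -/
theorem measurable_toyQ_uncurry (o : ℂ) : Measurable (Function.uncurry fun (_ : Unit) (v : E1) => (1 + o) * ((‖v‖ ^ 2 : ℝ) : ℂ)) := by
  have h : Measurable fun z : Unit × E1 => ((‖z.2‖ ^ 2 : ℝ) : ℂ) :=
    Complex.measurable_ofReal.comp (measurable_snd.norm.pow_const 2)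
  exact h.const_mul _

/-- **THE TOY FAMILY SATISFIES ALL THIRTEEN CLAUSES OF `TermOpGaussianParam`** on the window `univ`, centre `toyCtr`, history radius `1`,
operator room `R′ = 1/2`. [folklore] -/
theorem toyParam_termOpGaussianParam :
    TermOpGaussianParam toyParamTerm (Set.univ : Set (ℕ → ℝ)) toyCtr (fun _ => 1) (fun _ => 1 / 2) toyLam toyW toyN toyG toyQ
      cHalf cZero cOne cOne cOne := by
  intro k g _ U h _ X _ i
  refine ⟨?_, by norm_num [cHalf], aestronglyMeasurable_const, fun p => by simp [toyW, cOne], fun o _ => aestronglyMeasurable_const,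
    fun p => differentiableOn_const _, fun o _ p => by simp [toyN, cOne], aestronglyMeasurable_const, fun p v => ?_,
    fun o _ => (measurable_toyQ_uncurry o).aestronglyMeasurable, fun p v => ?_, fun o ho p v => toyQ_margin ho v, fun o _ => rfl⟩
  · change IsFiniteMeasure (Measure.dirac ()); infer_instance
  · simp only [toyG, cOne, cHalf, norm_one, one_mul]
    exact Real.one_le_exp (by positivity)
  · simp only [toyQ]
    fun_prop

/-- Hence, by the producer, the BALL FORM of `OutputRateOpHolomorphic` for the toy (reference measure `δ_() ⊗ vol` on `Unit × E1`). [folklore] -/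
theorem toyParam_termOpHolomorphicBall :
    TermOpHolomorphicBall toyParamTerm (Set.univ : Set (ℕ → ℝ)) toyCtr (fun _ => 1) (fun _ => 1 / 2)
      (fun k i h X => (toyLam k i h X).prod (volume : Measure E1))
      fun k i h X o z => toyW k i h X z.1 * toyN k i h X o z.1 * (toyG k i h X z.1 z.2 * Complex.exp (-toyQ k i h X o z.1 z.2)) :=
  termOpHolomorphicBall_of_gaussianParam toyParam_termOpGaussianParam

/-- … `TermOpLineAnalytic` on the ball class of radii `(1/4, 1)` (room `1/4 < 1/2`) — no analyticity hypothesis anywhere. [folklore] -/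
theorem toyParam_termOpLineAnalytic :
    TermOpLineAnalytic (ballClass toyCtr (fun _ => 1 / 4) fun _ => 1) toyParamTerm (Set.univ : Set (ℕ → ℝ)) :=
  termOpLineAnalytic_of_gaussianParam (ROp := fun _ => 1 / 4) (fun _ => by norm_num) toyParam_termOpGaussianParam

/-- … and `TermBound` with the weight = the producer's mass `paramMass` (`κ = 0`: the toy carriers have no tree length). [folklore] -/
theorem toyParam_termBound :
    TermBound (ballClass toyCtr (fun _ => 1 / 4) fun _ => 1) toyParamTerm (Set.univ : Set (ℕ → ℝ)) 0
      fun _ _ => (Real.pi / (1 / 2 / 2)) ^ (Module.finrank ℝ E1 / 2 : ℝ) := by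
  refine termBound_of_gaussianParam (ROp := fun _ => 1 / 4) (fun _ => by norm_num) toyParam_termOpGaussianParam
    fun k g _ U h _ X _ i => ?_
  have h1 : IsProbabilityMeasure (toyLam k i h X) := by change IsProbabilityMeasure (Measure.dirac ()); infer_instance
  simp only [zero_mul, neg_zero, Real.exp_zero, mul_one, paramMass, cHalf, cZero, cOne, probReal_univ, one_mul]
  exact le_rfl

end Summit.QuantumFields.BalabanUV.T4Continuum.OutputRateOpGaussianParamWitness

end
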